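import Summits.Ventures.PercRepro2.CaseOneStarPendant
import Summits.Ventures.PercRepro2.CaseOneGadgetUWOBMainQ
import Summits.Ventures.PercRepro2.CaseOneGadgetUWOBMainIQ
import Summits.Ventures.PercRepro2.CaseOneJOneGadgetUWOB

/-!
# `(ii)`, `(i)`, `(J1₁)`, `(J1)` and `(RV)` for `a₃` pendant at a uwob-gadget vertex
(blind cell PercRepro2, p1 g21; S5 §2.1 (K9) (l): the pendant lemma closed at the gadget `u ~ {w, o, b}`, `w ~ {u, a₁, a₂}`)

The pendant lemma (K8, `zSplitII_of_leaf_at` / `zSplitI_of_leaf_at`) reads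
`(ii)(a₃) = t · [(1 − t) · (ii-Q)(u) + t · (ii)(u)]` (and likewise `(i)`) for `a₃` a leaf at `u` with edge
weight `t`; at a gadget vertex `u` all four brackets are theorems in `G − e₀` (`zSplitII_of_gadgetUWOB`,
`zSplitIIQ_of_gadgetUWOB`, `zSplitI_of_gadgetUWOB`, `zSplitIQ_of_gadgetUWOB`; the structural predicate
`IsGadgetUWOB` counts the pendant edge), whence in `G` by the leaf-deletion transfer
(`CaseOneLeafDelete.lean`). So **`zSplitII_of_leaf_gadgetUWOB`**, **`zSplitI_of_leaf_gadgetUWOB`**,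
**`jOneOne_of_leaf_gadgetUWOB`**, **`jOne_of_leaf_gadgetUWOB`**, **`rv_of_leaf_gadgetUWOB`**: `(ii)`, `(i)`,
`(J1₁)`, `(J1)` and `(RV)` for every finite graph, every weight vector and every `a₃` of degree one whose
neighbour `u` is adjacent exactly to an unmarked `w` and to `o, b`, with `w` adjacent exactly to `u, a₁, a₂`
— the first pendant class two steps away from the marks. `IsPendantGadgetUWOBAt` is the six-edge description
of this class in `G` itself (`*_of_pendantGadgetUWOB`). Own code; standard axioms. -/

namespace Summit.Ventures.PercRepro2

namespace CaseOne

section Pendant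
variable {V : Type*} {E : Type*} [Fintype E] [DecidableEq E] [Fintype V] [DecidableEq V]
  {R : Type*} [Field R] [LinearOrder R] [IsStrictOrderedRing R]
variable {ends : E → Sym2 V} {o a₁ a₂ b u w a₃ : V} {e₀ : E}

/-- **`(ii)` for `a₃` pendant at a uwob-gadget vertex**: `a₃` is a leaf at `u` (edge `e₀`), and in `G − e₀`
the vertex `u` is a gadget vertex; every weight vector (the weight of `e₀` included). -/
theorem zSplitII_of_leaf_gadgetUWOB (p : E → R) (hp : IsProbVec p) (hl : IsLeafAt ends u a₃ e₀)
    (ho : o ≠ a₃) (h1 : a₁ ≠ a₃) (h2 : a₂ ≠ a₃) (hb : b ≠ a₃)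
    {euw euo eub ewa1 ewa2 : {e : E // e ≠ e₀}}
    (h : IsGadgetUWOB (restrictEnds ends e₀) o a₁ a₂ b u w euw euo eub ewa1 ewa2) :
    ZSplitII p ends o a₁ a₂ a₃ b :=
  zSplitII_of_leaf_at p hp hl o a₁ a₂ b ho h1 h2 hb
    (zSplitII_of_restrict p hl ho h1 h2 hl.ne hb
      (zSplitII_of_gadgetUWOB (restrictW p e₀) (IsProbVec.restrictW hp e₀) h))
    (zSplitIIQ_of_restrict p hl ho h1 h2 hl.ne hb
      (zSplitIIQ_of_gadgetUWOB (restrictW p e₀) (IsProbVec.restrictW hp e₀) h))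

/-- **`(i)` for `a₃` pendant at a uwob-gadget vertex**: the `(i)`-side of the same composition. -/
theorem zSplitI_of_leaf_gadgetUWOB (p : E → R) (hp : IsProbVec p) (hl : IsLeafAt ends u a₃ e₀)
    (ho : o ≠ a₃) (h1 : a₁ ≠ a₃) (h2 : a₂ ≠ a₃) (hb : b ≠ a₃)
    {euw euo eub ewa1 ewa2 : {e : E // e ≠ e₀}}
    (h : IsGadgetUWOB (restrictEnds ends e₀) o a₁ a₂ b u w euw euo eub ewa1 ewa2) :
    ZSplitI p ends o a₁ a₂ a₃ b :=
  zSplitI_of_leaf_at p hp hl o a₁ a₂ b ho h1 h2 hb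
    (zSplitI_of_restrict p hl ho h1 h2 hl.ne hb
      (zSplitI_of_gadgetUWOB (restrictW p e₀) (IsProbVec.restrictW hp e₀) h))
    (zSplitIQ_of_restrict p hl ho h1 h2 hl.ne hb
      (zSplitIQ_of_gadgetUWOB (restrictW p e₀) (IsProbVec.restrictW hp e₀) h))

/-- **`(J1₁)` for `a₃` pendant at a uwob-gadget vertex**: from `(i)` and `(ii)`. -/
theorem jOneOne_of_leaf_gadgetUWOB (p : E → R) (hp : IsProbVec p) (hl : IsLeafAt ends u a₃ e₀)
    (ho : o ≠ a₃) (h1 : a₁ ≠ a₃) (h2 : a₂ ≠ a₃) (hb : b ≠ a₃)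
    {euw euo eub ewa1 ewa2 : {e : E // e ≠ e₀}}
    (h : IsGadgetUWOB (restrictEnds ends e₀) o a₁ a₂ b u w euw euo eub ewa1 ewa2) :
    JOneOne p ends o a₁ a₂ a₃ b :=
  jOneOne_of_i_of_ii p ends o a₁ a₂ a₃ b (zSplitI_of_leaf_gadgetUWOB p hp hl ho h1 h2 hb h)
    (zSplitII_of_leaf_gadgetUWOB p hp hl ho h1 h2 hb h)

/-- **`(J1)` for `a₃` pendant at a uwob-gadget vertex**: `(J1₁)` and its mirror (`IsGadgetUWOB.swap`). -/
theorem jOne_of_leaf_gadgetUWOB (p : E → R) (hp : IsProbVec p) (hl : IsLeafAt ends u a₃ e₀)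
    (ho : o ≠ a₃) (h1 : a₁ ≠ a₃) (h2 : a₂ ≠ a₃) (hb : b ≠ a₃)
    {euw euo eub ewa1 ewa2 : {e : E // e ≠ e₀}}
    (h : IsGadgetUWOB (restrictEnds ends e₀) o a₁ a₂ b u w euw euo eub ewa1 ewa2) :
    JOne p ends o a₁ a₂ a₃ b :=
  jOne_of_jOneOne_of_mirror p ends o a₁ a₂ a₃ b
    (jOneOne_of_leaf_gadgetUWOB p hp hl ho h1 h2 hb h)
    (jOneOne_of_leaf_gadgetUWOB p hp hl ho h2 h1 hb h.swap)

/-- **`(RV)` for `a₃` pendant at a uwob-gadget vertex** (when the required-vertex world has mass). -/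
theorem rv_of_leaf_gadgetUWOB (p : E → R) (hp : IsProbVec p) (hl : IsLeafAt ends u a₃ e₀)
    (ho : o ≠ a₃) (h1 : a₁ ≠ a₃) (h2 : a₂ ≠ a₃) (hb : b ≠ a₃)
    {euw euo eub ewa1 ewa2 : {e : E // e ≠ e₀}}
    (h : IsGadgetUWOB (restrictEnds ends e₀) o a₁ a₂ b u w euw euo eub ewa1 ewa2)
    (hT : 0 < prob p (Tp ends a₁ a₂ a₃)) : RV p ends o a₁ a₂ a₃ b :=
  (rv_iff_ii p ends o a₁ a₂ a₃ b hT).2 (zSplitII_of_leaf_gadgetUWOB p hp hl ho h1 h2 hb h)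

end Pendant

/-! ## The six-edge description in `G` -/

section SixEdges
variable {V : Type*} {E : Type*}

/-- **The pendant gadget**: `a₃` is a leaf at `u` through `e₀`, the other edges at `u` are exactly
`euw = {w, u}`, `euo = {o, u}`, `eub = {b, u}`, and the edges at `w` are exactly `euw`, `ewa1 = {a₁, w}`,
`ewa2 = {a₂, w}` (five distinct edges), with the vertex inequalities of `IsGadgetUWOB` and
`a₁, a₂, o, b, w ≠ a₃`. -/
structure IsPendantGadgetUWOBAt (ends : E → Sym2 V) (o a₁ a₂ b u w a₃ : V)
    (e₀ euw euo eub ewa1 ewa2 : E) : Prop where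
  /-- the leaf -/
  leaf : IsLeafAt ends u a₃ e₀
  /-- the edge `{w, u}` -/
  ends_uw : ends euw = s(w, u)
  /-- the edge `{o, u}` -/
  ends_uo : ends euo = s(o, u)
  /-- the edge `{b, u}` -/
  ends_ub : ends eub = s(b, u)
  /-- the edge `{a₁, w}` -/
  ends_wa1 : ends ewa1 = s(a₁, w)
  /-- the edge `{a₂, w}` -/
  ends_wa2 : ends ewa2 = s(a₂, w)
  /-- distinct edges -/
  ne_uw_uo : euw ≠ euo
  /-- distinct edges -/
  ne_uw_ub : euw ≠ eub
  /-- distinct edges -/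
  ne_uw_wa1 : euw ≠ ewa1
  /-- distinct edges -/
  ne_uw_wa2 : euw ≠ ewa2
  /-- distinct edges -/
  ne_uo_ub : euo ≠ eub
  /-- distinct edges -/
  ne_uo_wa1 : euo ≠ ewa1
  /-- distinct edges -/
  ne_uo_wa2 : euo ≠ ewa2
  /-- distinct edges -/
  ne_ub_wa1 : eub ≠ ewa1
  /-- distinct edges -/
  ne_ub_wa2 : eub ≠ ewa2
  /-- distinct edges -/
  ne_wa1_wa2 : ewa1 ≠ ewa2
  /-- no other edge at `u` -/
  unique_u : ∀ e, u ∈ ends e → e = e₀ ∨ e = euw ∨ e = euo ∨ e = eub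
  /-- no other edge at `w` -/
  unique_w : ∀ e, w ∈ ends e → e = euw ∨ e = ewa1 ∨ e = ewa2
  /-- `w ≠ u` -/
  ne_wu : w ≠ u
  /-- `o ≠ u` -/
  ne_ou : o ≠ u
  /-- `b ≠ u` -/
  ne_bu : b ≠ u
  /-- `a₁ ≠ u` -/
  ne_a1u : a₁ ≠ u
  /-- `a₂ ≠ u` -/
  ne_a2u : a₂ ≠ u
  /-- `a₁ ≠ w` -/
  ne_a1w : a₁ ≠ w
  /-- `a₂ ≠ w` -/
  ne_a2w : a₂ ≠ w
  /-- `o ≠ w` -/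
  ne_ow : o ≠ w
  /-- `b ≠ w` -/
  ne_bw : b ≠ w
  /-- `a₁ ≠ a₃` -/
  ne_a1' : a₁ ≠ a₃
  /-- `a₂ ≠ a₃` -/
  ne_a2' : a₂ ≠ a₃
  /-- `o ≠ a₃` -/
  ne_o' : o ≠ a₃
  /-- `b ≠ a₃` -/
  ne_b' : b ≠ a₃
  /-- `w ≠ a₃` -/
  ne_w' : w ≠ a₃

variable {ends : E → Sym2 V} {o a₁ a₂ b u w a₃ : V} {e₀ euw euo eub ewa1 ewa2 : E}

/-- An edge `{x, y}` with `x, y ≠ u` is not the leaf edge `{u, a₃}`. -/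
lemma ne_leaf_edge_of_ends' (hl : IsLeafAt ends u a₃ e₀) {e : E} {x y : V} (he : ends e = s(x, y))
    (hx : x ≠ u) (hy : y ≠ u) : e ≠ e₀ := by
  rintro rfl
  rw [hl.ends_eq] at he
  rcases Sym2.eq_iff.1 he with ⟨h, _⟩ | ⟨h, _⟩
  · exact hx h.symm
  · exact hy h.symm

/-- In `G − e₀` the vertex `u` of a pendant gadget is a gadget vertex. -/
theorem IsPendantGadgetUWOBAt.gadgetUWOB
    (h : IsPendantGadgetUWOBAt ends o a₁ a₂ b u w a₃ e₀ euw euo eub ewa1 ewa2) :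
    IsGadgetUWOB (restrictEnds ends e₀) o a₁ a₂ b u w
      ⟨euw, ne_leaf_edge_of_ends h.leaf h.ends_uw h.ne_w'⟩
      ⟨euo, ne_leaf_edge_of_ends h.leaf h.ends_uo h.ne_o'⟩
      ⟨eub, ne_leaf_edge_of_ends h.leaf h.ends_ub h.ne_b'⟩
      ⟨ewa1, ne_leaf_edge_of_ends' h.leaf h.ends_wa1 h.ne_a1u h.ne_wu⟩
      ⟨ewa2, ne_leaf_edge_of_ends' h.leaf h.ends_wa2 h.ne_a2u h.ne_wu⟩ where
  ends_uw := h.ends_uw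
  ends_uo := h.ends_uo
  ends_ub := h.ends_ub
  ends_wa1 := h.ends_wa1
  ends_wa2 := h.ends_wa2
  ne_uw_uo := fun h' => h.ne_uw_uo (congrArg Subtype.val h')
  ne_uw_ub := fun h' => h.ne_uw_ub (congrArg Subtype.val h')
  ne_uw_wa1 := fun h' => h.ne_uw_wa1 (congrArg Subtype.val h')
  ne_uw_wa2 := fun h' => h.ne_uw_wa2 (congrArg Subtype.val h')
  ne_uo_ub := fun h' => h.ne_uo_ub (congrArg Subtype.val h')
  ne_uo_wa1 := fun h' => h.ne_uo_wa1 (congrArg Subtype.val h')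
  ne_uo_wa2 := fun h' => h.ne_uo_wa2 (congrArg Subtype.val h')
  ne_ub_wa1 := fun h' => h.ne_ub_wa1 (congrArg Subtype.val h')
  ne_ub_wa2 := fun h' => h.ne_ub_wa2 (congrArg Subtype.val h')
  ne_wa1_wa2 := fun h' => h.ne_wa1_wa2 (congrArg Subtype.val h')
  unique_u := by
    rintro ⟨e, he0⟩ hu
    rcases h.unique_u e hu with rfl | rfl | rfl | rfl
    · exact absurd rfl he0
    · exact Or.inl rfl
    · exact Or.inr (Or.inl rfl)
    · exact Or.inr (Or.inr rfl)
  unique_w := by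
    rintro ⟨e, _⟩ hw
    rcases h.unique_w e hw with rfl | rfl | rfl
    · exact Or.inl rfl
    · exact Or.inr (Or.inl rfl)
    · exact Or.inr (Or.inr rfl)
  ne_wu := h.ne_wu
  ne_ou := h.ne_ou
  ne_bu := h.ne_bu
  ne_a1u := h.ne_a1u
  ne_a2u := h.ne_a2u
  ne_a1w := h.ne_a1w
  ne_a2w := h.ne_a2w
  ne_ow := h.ne_ow
  ne_bw := h.ne_bw

end SixEdges

section PendantSix
variable {V : Type*} {E : Type*} [Fintype E] [DecidableEq E] [Fintype V] [DecidableEq V]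
  {R : Type*} [Field R] [LinearOrder R] [IsStrictOrderedRing R]
variable {ends : E → Sym2 V} {o a₁ a₂ b u w a₃ : V} {e₀ euw euo eub ewa1 ewa2 : E}

/-- **`(ii)` for the pendant gadget in `G`**: `a₃` a leaf at `u`, `u` adjacent to `a₃, w, o, b` and nothing
else, `w` adjacent to `u, a₁, a₂` and nothing else; every finite graph, every weight vector. -/
theorem zSplitII_of_pendantGadgetUWOB (p : E → R) (hp : IsProbVec p)
    (h : IsPendantGadgetUWOBAt ends o a₁ a₂ b u w a₃ e₀ euw euo eub ewa1 ewa2) :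
    ZSplitII p ends o a₁ a₂ a₃ b :=
  zSplitII_of_leaf_gadgetUWOB p hp h.leaf h.ne_o' h.ne_a1' h.ne_a2' h.ne_b' h.gadgetUWOB

/-- **`(i)` for the pendant gadget in `G`.** -/
theorem zSplitI_of_pendantGadgetUWOB (p : E → R) (hp : IsProbVec p)
    (h : IsPendantGadgetUWOBAt ends o a₁ a₂ b u w a₃ e₀ euw euo eub ewa1 ewa2) :
    ZSplitI p ends o a₁ a₂ a₃ b :=
  zSplitI_of_leaf_gadgetUWOB p hp h.leaf h.ne_o' h.ne_a1' h.ne_a2' h.ne_b' h.gadgetUWOB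

/-- **`(J1₁)` for the pendant gadget in `G`.** -/
theorem jOneOne_of_pendantGadgetUWOB (p : E → R) (hp : IsProbVec p)
    (h : IsPendantGadgetUWOBAt ends o a₁ a₂ b u w a₃ e₀ euw euo eub ewa1 ewa2) :
    JOneOne p ends o a₁ a₂ a₃ b :=
  jOneOne_of_leaf_gadgetUWOB p hp h.leaf h.ne_o' h.ne_a1' h.ne_a2' h.ne_b' h.gadgetUWOB

/-- **`(J1)` for the pendant gadget in `G`.** -/
theorem jOne_of_pendantGadgetUWOB (p : E → R) (hp : IsProbVec p)
    (h : IsPendantGadgetUWOBAt ends o a₁ a₂ b u w a₃ e₀ euw euo eub ewa1 ewa2) :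
    JOne p ends o a₁ a₂ a₃ b :=
  jOne_of_leaf_gadgetUWOB p hp h.leaf h.ne_o' h.ne_a1' h.ne_a2' h.ne_b' h.gadgetUWOB

/-- **`(RV)` for the pendant gadget in `G`** (when the required-vertex world has mass). -/
theorem rv_of_pendantGadgetUWOB (p : E → R) (hp : IsProbVec p)
    (h : IsPendantGadgetUWOBAt ends o a₁ a₂ b u w a₃ e₀ euw euo eub ewa1 ewa2)
    (hT : 0 < prob p (Tp ends a₁ a₂ a₃)) : RV p ends o a₁ a₂ a₃ b :=
  (rv_iff_ii p ends o a₁ a₂ a₃ b hT).2 (zSplitII_of_pendantGadgetUWOB p hp h)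

end PendantSix

end CaseOne

end Summit.Ventures.PercRepro2
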